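import Literature.NumberTheory.GaloisRepresentations.LevelFieldLocalization
import Literature.NumberTheory.GaloisRepresentations.AbsGaloisGroupProofs
import Literature.NumberTheory.GaloisRepresentations.TateDualityCounting
import Literature.NumberTheory.GaloisRepresentations.ContinuousCohomologyConnecting
import HarnessLib

/-!
# Conjugate restrictions give isomorphic representations; the tower restriction `res_{E/K} ∘ res_{F/E}`
# versus the direct restriction `res_{F/K}`

Topic `Literature/NumberTheory/GaloisRepresentations`, namespace `Literature.NumberTheory.GaloisRepresentations`.

For a continuous representation `ρ : G → GL(M)` and two continuous homomorphisms `φ, ψ : H → G` that are CONJUGATE,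
`ψ(x) = γ φ(x) γ⁻¹` for one `γ ∈ G`, the operator `ρ(γ)` is an isomorphism of topological `H`-representations
`ρ ∘ φ ≅ ρ ∘ ψ` (`ContinuousRep.restrictConjIso`; `ρ(γ) ρ(φ x) = ρ(ψ x) ρ(γ)`), hence induces bijections on continuous
cohomology (`bijective_cohomologyMap_restrictConjHom`, the tree's `continuousCohomologyEquivOfIso`) — Serre, *Galois
Cohomology*, I §2.4 (compatible pairs; an inner automorphism acts trivially up to the isomorphism it induces).

Application (the reason for this file): for a tower of fields `K ⊆ E ⊆ F` the tree has TWO restriction maps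
`Γ_F → Γ_K` — the direct one `absGaloisRestrict K F` (through the chosen `K`-embedding `K̄ → F̄`) and the tower one
`absGaloisRestrictTower K E F = res_{E/K} ∘ res_{F/E}` (through `K̄ → Ē → F̄`). They are conjugate by ONE element of
`Γ_K` (`exists_absGaloisRestrictTower_eq_conj`, from the tree's `absGaloisRestrict_isConj_of_algHom_holds`: two
`K`-embeddings `K̄ → F̄` differ by an element of `Γ_K`, Milne FT Ch. 7), so for every continuous representation `T` of
`Γ_K` the two `Γ_F`-representations `T|_{Γ_F}` (`T.restrict (absGaloisRestrict K F)`, e.g. the tree's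
`PAdicHodge.restrictedTateRep W F p`) and `(T|_{Γ_E})|_{Γ_F}` (`(T.restrict (absGaloisRestrict K E)).restrict
(absGaloisRestrict E F)`, the "tower representation" of `PAdicHodge.DualExpEllipticTower`) are ISOMORPHIC
(`restrictTowerIso`), with bijective induced maps on `Hⁿ` and an explicit formula on crossed homomorphisms
(`cohomologyMap_restrictTowerIso_hom_oneCocycleClass`: `[η] ↦ [σ ↦ T(γ) η(σ)]`). This is floor (e) («tower transport»)
of the hT₂ programme of crux K★ `stmt-BirchSwinnertonDyer-22226` (memo `Summits/BirchSwinnertonDyer/BirchSwinnertonDyer/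
Cruxes/StarredOptimalManinUnitFiveSeven/Lines/kato-lever-hT2-programme.md`): it lets the local Tate pairing and its
duality theorem, proved for `restrictedTateRep W F p`, be read on the tower representation. BSD is not proved by any of
this.

## References
* J.-P. Serre, *Galois Cohomology* (1997), I §2.4 (compatible pairs), I §5.8. [SerreGaloisCohomology1997]
* J. S. Milne, *Fields and Galois Theory* (2022), Ch. 7, footnote after Prop. 7.6 (the absolute Galois group and its
  restriction maps are defined up to an inner automorphism). [MilneFT2022]
-/

noncomputable section

open CategoryTheory Field Function

namespace Literature.NumberTheory.GaloisRepresentations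

universe u v

namespace ContinuousRep

section Conj

variable {G : Type u} [Group G] [TopologicalSpace G] {H : Type u} [Group H] [TopologicalSpace H]
  {A : Type v} [CommRing A] [TopologicalSpace A]
  {M : Type u} [AddCommGroup M] [Module A M] [TopologicalSpace M] [IsTopologicalAddGroup M]
  [ContinuousSMul A M] (ρ : ContinuousRep G A M)

/-- **`ρ(γ) : ρ ∘ φ ⟶ ρ ∘ ψ`** for conjugate `ψ = γ φ γ⁻¹`: the operator `ρ(γ)` as a morphism of topological
`H`-representations (`ρ(γ) ρ(φ x) = ρ(γ φ x) = ρ(ψ x γ) = ρ(ψ x) ρ(γ)`). [cite: SerreGaloisCohomology1997, I §2.4 (compatible pairs)] -/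
def restrictConjHom (φ ψ : H →ₜ* G) (γ : G) (h : ∀ x, ψ x = γ * φ x * γ⁻¹) :
    (ρ.restrict φ).toTopRep ⟶ (ρ.restrict ψ).toTopRep :=
  TopRep.ofHom ⟨ρ.toContRepresentation γ, fun x => by
    ext v
    change (ρ γ * ρ (φ x)) v = (ρ (ψ x) * ρ γ) v
    rw [← map_mul, ← map_mul, h, inv_mul_cancel_right]⟩

/-- The morphism `restrictConjHom` is `v ↦ ρ(γ) v`. [cite: SerreGaloisCohomology1997, I §2.4 (compatible pairs)] -/
@[simp] theorem restrictConjHom_hom_apply (φ ψ : H →ₜ* G) (γ : G) (h : ∀ x, ψ x = γ * φ x * γ⁻¹) (v : M) :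
    (ρ.restrictConjHom φ ψ γ h).hom v = ρ γ v := rfl

/-- If `ψ = γ φ γ⁻¹` then `φ = γ⁻¹ ψ (γ⁻¹)⁻¹`. [folklore] -/
private theorem conj_symm (φ ψ : H →ₜ* G) (γ : G) (h : ∀ x, ψ x = γ * φ x * γ⁻¹) (x : H) :
    φ x = γ⁻¹ * ψ x * γ⁻¹⁻¹ := by
  rw [h, inv_inv]; group

omit [IsTopologicalAddGroup M] [ContinuousSMul A M] in
/-- `ρ(γ⁻¹) (ρ(γ) v) = v`. [folklore] -/
private theorem apply_inv_apply (γ : G) (v : M) : ρ γ⁻¹ (ρ γ v) = v := by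
  change (ρ γ⁻¹ * ρ γ) v = v
  rw [← map_mul, inv_mul_cancel, map_one, Module.End.one_apply]

/-- **Conjugate restrictions are isomorphic: `ρ ∘ φ ≅ ρ ∘ ψ`** for `ψ = γ φ γ⁻¹`, the isomorphism being `ρ(γ)` with
inverse `ρ(γ⁻¹)`. [cite: SerreGaloisCohomology1997, I §2.4 (compatible pairs)] -/
def restrictConjIso (φ ψ : H →ₜ* G) (γ : G) (h : ∀ x, ψ x = γ * φ x * γ⁻¹) :
    (ρ.restrict φ).toTopRep ≅ (ρ.restrict ψ).toTopRep where
  hom := ρ.restrictConjHom φ ψ γ h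
  inv := ρ.restrictConjHom ψ φ γ⁻¹ (conj_symm φ ψ γ h)
  hom_inv_id := TopRep.hom_ext (ContIntertwiningMap.ext (ContinuousLinearMap.ext fun v => by
    change ρ γ⁻¹ (ρ γ v) = v
    exact apply_inv_apply ρ γ v))
  inv_hom_id := TopRep.hom_ext (ContIntertwiningMap.ext (ContinuousLinearMap.ext fun v => by
    change ρ γ (ρ γ⁻¹ v) = v
    simpa only [inv_inv] using apply_inv_apply ρ γ⁻¹ v))

/-- The isomorphism `restrictConjIso` has `hom = restrictConjHom` (`rfl`). [cite: SerreGaloisCohomology1997, I §2.4 (compatible pairs)] -/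
@[simp] theorem restrictConjIso_hom (φ ψ : H →ₜ* G) (γ : G) (h : ∀ x, ψ x = γ * φ x * γ⁻¹) :
    (ρ.restrictConjIso φ ψ γ h).hom = ρ.restrictConjHom φ ψ γ h := rfl

/-- The inverse of `restrictConjIso` is `v ↦ ρ(γ⁻¹) v`. [cite: SerreGaloisCohomology1997, I §2.4 (compatible pairs)] -/
@[simp] theorem restrictConjIso_inv_hom_apply (φ ψ : H →ₜ* G) (γ : G) (h : ∀ x, ψ x = γ * φ x * γ⁻¹) (v : M) :
    (ρ.restrictConjIso φ ψ γ h).inv.hom v = ρ γ⁻¹ v := rfl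

variable [IsTopologicalGroup H]

/-- **`Hⁿ(ρ(γ)) : Hⁿ(H, ρ ∘ φ) → Hⁿ(H, ρ ∘ ψ)` is bijective** (cohomology of the isomorphism `restrictConjIso`).
[cite: SerreGaloisCohomology1997, I §2.4 (compatible pairs)] -/
theorem bijective_cohomologyMap_restrictConjHom (φ ψ : H →ₜ* G) (γ : G) (h : ∀ x, ψ x = γ * φ x * γ⁻¹) (q : ℕ) :
    Bijective (cohomologyMap (ρ.restrictConjHom φ ψ γ h) q).hom :=
  (continuousCohomologyEquivOfIso (ρ.restrictConjIso φ ψ γ h) q).bijective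

/-- `H¹(ρ(γ))` on crossed homomorphisms: `[η] ↦ [x ↦ ρ(γ) η(x)]`. [cite: SerreGaloisCohomology1997, I §2.4 (compatible pairs) with I §5.8] -/
theorem cohomologyMap_restrictConjHom_oneCocycleClass (φ ψ : H →ₜ* G) (γ : G) (h : ∀ x, ψ x = γ * φ x * γ⁻¹)
    (η : contOneCocycles (ρ.restrict φ).toTopRep) :
    cohomologyMap (ρ.restrictConjHom φ ψ γ h) 1 (oneCocycleClass _ η) =
      oneCocycleClass _ (contOneCocycles.pullback (ContinuousMonoidHom.id H)
        (resIdHom (ρ.restrictConjHom φ ψ γ h)) η) :=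
  cohomologyMap_oneCocycleClass _ η

omit [IsTopologicalGroup H] in
/-- The transported crossed homomorphism is `x ↦ ρ(γ) (η x)`. [cite: SerreGaloisCohomology1997, I §5.8] -/
theorem pullback_restrictConjHom_apply (φ ψ : H →ₜ* G) (γ : G) (h : ∀ x, ψ x = γ * φ x * γ⁻¹)
    (η : contOneCocycles (ρ.restrict φ).toTopRep) (x : H) :
    (contOneCocycles.pullback (ContinuousMonoidHom.id H) (resIdHom (ρ.restrictConjHom φ ψ γ h)) η).1 x =
      ρ γ (η.1 x) := rfl

/-- **Every class of `H¹(H, ρ ∘ ψ)` is `H¹(ρ(γ))` of a class of `H¹(H, ρ ∘ φ)`, on cocycles**: for every crossed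
homomorphism `η'` of `ρ ∘ ψ` there is a crossed homomorphism `η` of `ρ ∘ φ` with `[x ↦ ρ(γ) η(x)] = [η']`.
[cite: SerreGaloisCohomology1997, I §2.4 (compatible pairs) with I §5.8] -/
theorem exists_oneCocycleClass_pullback_restrictConjHom_eq (φ ψ : H →ₜ* G) (γ : G)
    (h : ∀ x, ψ x = γ * φ x * γ⁻¹) (η' : contOneCocycles (ρ.restrict ψ).toTopRep) :
    ∃ η : contOneCocycles (ρ.restrict φ).toTopRep,
      oneCocycleClass _ (contOneCocycles.pullback (ContinuousMonoidHom.id H)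
        (resIdHom (ρ.restrictConjHom φ ψ γ h)) η) = oneCocycleClass _ η' := by
  obtain ⟨y, hy⟩ := (ρ.bijective_cohomologyMap_restrictConjHom φ ψ γ h 1).2 (oneCocycleClass _ η')
  obtain ⟨η, rfl⟩ := oneCocycleClass_surjective _ y
  exact ⟨η, by rw [← cohomologyMap_restrictConjHom_oneCocycleClass, hy]⟩

end Conj

end ContinuousRep

/-! ### The tower restriction versus the direct restriction -/

section Tower

variable (K E F : Type u) [Field K] [Field E] [Field F] [Algebra K E] [Algebra E F] [Algebra K F]
  [IsScalarTower K E F]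

/-- **`res_{E/K} ∘ res_{F/E}` and `res_{F/K}` are conjugate by one element of `Γ_K`**: the two `K`-embeddings
`K̄ → F̄` — the chosen one and the composite `K̄ → Ē → F̄` — differ by an element of `Γ_K` (the tree's
`absGaloisRestrict_isConj_of_algHom_holds`, fed with the compatibility `absClosureEmbedding_absGaloisRestrictTower_smul`).
[cite: MilneFT2022, Ch. 7, footnote after Prop. 7.6] -/
theorem exists_absGaloisRestrictTower_eq_conj :
    ∃ γ : absoluteGaloisGroup K, ∀ σ : absoluteGaloisGroup F,
      absGaloisRestrictTower K E F σ = γ * absGaloisRestrict K F σ * γ⁻¹ :=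
  absGaloisRestrict_isConj_of_algHom_holds K F
    (((absClosureEmbedding E F).restrictScalars K).comp (absClosureEmbedding K E))
    (absGaloisRestrictTower K E F) fun σ x => absClosureEmbedding_absGaloisRestrictTower_smul K E F σ x

/-- **An EMBEDDING element of the tower**: there is `τ ∈ Γ_K` with `ι_{F/E}(ι_{E/K} x) = ι_{F/K}(τ x)` for all `x ∈ K̄`
(the composite `K`-embedding `K̄ → Ē → F̄` factors through the chosen one `ι_{F/K} : K̄ → F̄` by an element of `Γ_K` —
uniqueness of the algebraic closure up to `K`-isomorphism, the tree's `exists_absClosureEmbedding_comp_eq`). Such a `τ`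
conjugates the two restriction maps (`absGaloisRestrictTower_eq_conj_of_smul`); the converse fails in general (a bare
conjugator is determined only up to the centraliser of `res_{F/K}(Γ_F)`), which is why `towerConjElement` below is CHOSEN
among the embedding elements. [cite: MilneFT2022, Ch. 6 Thm 6.8 & Rmk 6.9; Ch. 7, footnote after Prop. 7.6] -/
theorem exists_absClosureEmbedding_tower_eq_smul :
    ∃ τ : absoluteGaloisGroup K, ∀ x : AlgebraicClosure K,
      absClosureEmbedding E F (absClosureEmbedding K E x) = absClosureEmbedding K F (τ • x) := by
  obtain ⟨τ, hτ⟩ := exists_absClosureEmbedding_comp_eq K F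
    (((absClosureEmbedding E F).restrictScalars K).comp (absClosureEmbedding K E))
  exact ⟨τ, fun x => (hτ x).symm⟩

omit [IsScalarTower K E F] in
/-- **An embedding element conjugates the restriction maps**: if `ι_{F/E} ∘ ι_{E/K} = ι_{F/K} ∘ τ` on `K̄`, then
`res_{E/K}(res_{F/E} σ) = τ⁻¹ · res_{F/K}(σ) · τ` for every `σ ∈ Γ_F` (apply `ι_{F/K}`, which is injective, and use the
faithfulness of the action of `Γ_K` on `K̄`). [cite: MilneFT2022, Ch. 7, footnote after Prop. 7.6] -/
theorem absGaloisRestrictTower_eq_conj_of_smul {τ : absoluteGaloisGroup K}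
    (hτ : ∀ x : AlgebraicClosure K, absClosureEmbedding E F (absClosureEmbedding K E x) = absClosureEmbedding K F (τ • x))
    (σ : absoluteGaloisGroup F) :
    absGaloisRestrictTower K E F σ = τ⁻¹ * absGaloisRestrict K F σ * τ⁻¹⁻¹ := by
  have key : τ * absGaloisRestrictTower K E F σ = absGaloisRestrict K F σ * τ := by
    refine FaithfulSMul.eq_of_smul_eq_smul (α := AlgebraicClosure K) fun x => ?_
    apply (absClosureEmbedding K F).toRingHom.injective
    change absClosureEmbedding K F ((τ * absGaloisRestrictTower K E F σ) • x) =
      absClosureEmbedding K F ((absGaloisRestrict K F σ * τ) • x)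
    rw [mul_smul, mul_smul, ← hτ, absClosureEmbedding_absGaloisRestrictTower_smul, hτ, absGaloisRestrict_apply_smul]
  rw [inv_inv, mul_assoc, ← key, inv_mul_cancel_left]

/-- **The conjugating element** `γ_{K ⊆ E ⊆ F} ∈ Γ_K` with `res_{E/K} ∘ res_{F/E} = γ · res_{F/K} · γ⁻¹`, CHOSEN so that
`γ⁻¹` is an embedding element of the tower (`ι_{F/E} ∘ ι_{E/K} = ι_{F/K} ∘ γ⁻¹`,
`absClosureEmbedding_tower_eq_towerConjElement_inv_smul`): with this choice the transport `T(γ)⁻¹` behind `restrictTowerIso`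
(and behind `EllipticCurves.tatePairingPointTower`) is compatible with the field embeddings, so that statements proved
with an embedding element (e.g. the restriction degree formula `EllipticCurves.tatePairingPoint_res`) apply to it.
[cite: MilneFT2022, Ch. 7, footnote after Prop. 7.6] -/
def towerConjElement : absoluteGaloisGroup K :=
  (Classical.choose (exists_absClosureEmbedding_tower_eq_smul K E F))⁻¹

/-- **`γ⁻¹` is an embedding element**: `ι_{F/E}(ι_{E/K} x) = ι_{F/K}(γ⁻¹ x)` for `γ = towerConjElement K E F` and all `x ∈ K̄`.
[cite: MilneFT2022, Ch. 6 Thm 6.8 & Rmk 6.9; Ch. 7, footnote after Prop. 7.6] -/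
theorem absClosureEmbedding_tower_eq_towerConjElement_inv_smul (x : AlgebraicClosure K) :
    absClosureEmbedding E F (absClosureEmbedding K E x) = absClosureEmbedding K F ((towerConjElement K E F)⁻¹ • x) := by
  rw [towerConjElement, inv_inv]
  exact Classical.choose_spec (exists_absClosureEmbedding_tower_eq_smul K E F) x

/-- Defining property of `towerConjElement`. [cite: MilneFT2022, Ch. 7, footnote after Prop. 7.6] -/
theorem absGaloisRestrictTower_eq_conj (σ : absoluteGaloisGroup F) :
    absGaloisRestrictTower K E F σ = towerConjElement K E F * absGaloisRestrict K F σ * (towerConjElement K E F)⁻¹ := by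
  simpa only [inv_inv] using
    absGaloisRestrictTower_eq_conj_of_smul K E F (absClosureEmbedding_tower_eq_towerConjElement_inv_smul K E F) σ

/-- The same for the composite `(res_{E/K}).comp (res_{F/E})` (definitionally `absGaloisRestrictTower`).
[cite: MilneFT2022, Ch. 7, footnote after Prop. 7.6] -/
theorem absGaloisRestrict_comp_eq_conj (σ : absoluteGaloisGroup F) :
    (absGaloisRestrict K E).comp (absGaloisRestrict E F) σ =
      towerConjElement K E F * absGaloisRestrict K F σ * (towerConjElement K E F)⁻¹ :=
  absGaloisRestrictTower_eq_conj K E F σ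

variable {K E F}
variable {A : Type v} [CommRing A] [TopologicalSpace A] {M : Type u} [AddCommGroup M] [Module A M]
  [TopologicalSpace M] [IsTopologicalAddGroup M] [ContinuousSMul A M]
  (T : ContinuousRep (absoluteGaloisGroup K) A M)

/-- **`T|_{Γ_F} ≅ (T|_{Γ_E})|_{Γ_F}`**: the direct restriction of a continuous representation `T` of `Γ_K` along
`res_{F/K}` and its tower restriction along `res_{E/K} ∘ res_{F/E}` are isomorphic topological `Γ_F`-representations,
via `T(γ)` for the conjugating element `γ = towerConjElement K E F` (the two restrictions `(T.restrict ·).restrict ·`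
and `T.restrict (·.comp ·)` agree definitionally, `ContinuousRep.restrict_comp`). [cite: SerreGaloisCohomology1997, I §2.4 (compatible pairs)] [cite: MilneFT2022, Ch. 7, footnote after Prop. 7.6] -/
def restrictTowerIso :
    (T.restrict (absGaloisRestrict K F)).toTopRep ≅
      ((T.restrict (absGaloisRestrict K E)).restrict (absGaloisRestrict E F)).toTopRep :=
  T.restrictConjIso (absGaloisRestrict K F) ((absGaloisRestrict K E).comp (absGaloisRestrict E F))
    (towerConjElement K E F) (absGaloisRestrict_comp_eq_conj K E F)

/-- The isomorphism `restrictTowerIso` is `v ↦ T(γ) v`, `γ = towerConjElement K E F`. [cite: SerreGaloisCohomology1997, I §2.4 (compatible pairs)] -/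
@[simp] theorem restrictTowerIso_hom_hom_apply (v : M) :
    (restrictTowerIso (E := E) (F := F) T).hom.hom v = T (towerConjElement K E F) v := rfl

/-- Its inverse is `v ↦ T(γ⁻¹) v`. [cite: SerreGaloisCohomology1997, I §2.4 (compatible pairs)] -/
@[simp] theorem restrictTowerIso_inv_hom_apply (v : M) :
    (restrictTowerIso (E := E) (F := F) T).inv.hom v = T (towerConjElement K E F)⁻¹ v := rfl

/-- **`Hⁿ(Γ_F, T|_{Γ_F}) ≅ Hⁿ(Γ_F, (T|_{Γ_E})|_{Γ_F})`**: the induced map of `restrictTowerIso` on continuous cohomology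
is bijective. [cite: SerreGaloisCohomology1997, I §2.4 (compatible pairs)] -/
theorem bijective_cohomologyMap_restrictTowerIso_hom (q : ℕ) :
    Bijective (cohomologyMap (restrictTowerIso (E := E) (F := F) T).hom q).hom :=
  (continuousCohomologyEquivOfIso (restrictTowerIso (E := E) (F := F) T) q).bijective

/-- The inverse direction is bijective too. [cite: SerreGaloisCohomology1997, I §2.4 (compatible pairs)] -/
theorem bijective_cohomologyMap_restrictTowerIso_inv (q : ℕ) :
    Bijective (cohomologyMap (restrictTowerIso (E := E) (F := F) T).inv q).hom :=
  (continuousCohomologyEquivOfIso (restrictTowerIso (E := E) (F := F) T).symm q).bijective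

/-- `H¹` of `restrictTowerIso` on crossed homomorphisms: `[η] ↦ [σ ↦ T(γ) η(σ)]`. [cite: SerreGaloisCohomology1997, I §2.4 (compatible pairs) with I §5.8] -/
theorem cohomologyMap_restrictTowerIso_hom_oneCocycleClass
    (η : contOneCocycles (T.restrict (absGaloisRestrict K F)).toTopRep) :
    cohomologyMap (restrictTowerIso (E := E) (F := F) T).hom 1 (oneCocycleClass _ η) =
      oneCocycleClass _ (contOneCocycles.pullback (ContinuousMonoidHom.id _)
        (resIdHom (restrictTowerIso (E := E) (F := F) T).hom) η) :=
  cohomologyMap_oneCocycleClass _ η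

/-- The transported crossed homomorphism of the tower representation is `σ ↦ T(γ) (η σ)`. [cite: SerreGaloisCohomology1997, I §5.8] -/
theorem pullback_restrictTowerIso_hom_apply (η : contOneCocycles (T.restrict (absGaloisRestrict K F)).toTopRep)
    (σ : absoluteGaloisGroup F) :
    (contOneCocycles.pullback (ContinuousMonoidHom.id _) (resIdHom (restrictTowerIso (E := E) (F := F) T).hom) η).1 σ =
      T (towerConjElement K E F) (η.1 σ) := rfl

/-- **Every crossed homomorphism of the tower representation is, up to a coboundary, `σ ↦ T(γ) η(σ)`** for a crossed
homomorphism `η` of the direct restriction `T|_{Γ_F}` — the form in which statements proved for `T|_{Γ_F}` (e.g. the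
local Tate pairing of `PAdicHodge.restrictedTateRep W F p` and its duality) are read on the tower representation
`(T|_{Γ_{F₀}})|_{Γ_F}` of `PAdicHodge.DualExpEllipticTower`. [cite: SerreGaloisCohomology1997, I §2.4 (compatible pairs) with I §5.8] -/
theorem exists_oneCocycleClass_tower_eq
    (η' : contOneCocycles ((T.restrict (absGaloisRestrict K E)).restrict (absGaloisRestrict E F)).toTopRep) :
    ∃ η : contOneCocycles (T.restrict (absGaloisRestrict K F)).toTopRep,
      oneCocycleClass _ (contOneCocycles.pullback (ContinuousMonoidHom.id _)
        (resIdHom (restrictTowerIso (E := E) (F := F) T).hom) η) = oneCocycleClass _ η' :=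
  T.exists_oneCocycleClass_pullback_restrictConjHom_eq _ _ _ (absGaloisRestrict_comp_eq_conj K E F) η'

end Tower

end Literature.NumberTheory.GaloisRepresentations

end
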